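import Summits.ResolutionOfSingularities.ResolutionOfSingularities.Theorems.MarkedTransferCampaignW46TypedProcedure
import Literature.AlgebraicGeometry.Resolution.EffectiveResolution
import HarnessLib

/-!
# [OURS · L1 W4.6, rung (iv) «large characteristic»] STATEMENTS of the rung-(iv) split over the typed Th. 16.6 procedure
# — campaign s46 of cell res-hironaka (LADDER-RESOLUTION rung L, D-0089); host route MarkedTransfer,
# `--kind definition --supports stmt-ResolutionOfSingularities-16155 --as helper`; statement-only lane (res-L1-type-o1)

HONEST FRAMING. Everything below is OURS (campaign statements of slot W4.6, typed in the statement-only lane on the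
hand-over of prover res-L1-s46-pv-7, STATUS 2026-08-26T22:41:48Z «PROPOSED ITEM SIGNATURES (A)/(B)»). NOTHING here is a
statement of H. Hironaka's manuscript [Hironaka2017] and nothing is asserted: every decl is a `def … : Prop` (a witness
SHAPE or a statement PREDICATE with parameters). The manuscript's typed candidates enter only through the OURS vocabulary
of `Theorems/MarkedTransferCampaignW46TypedProcedure.lean` (`CampaignW46.Notions`, `Resume`, `Reading`, `Regime`,
`Step`, `DecreaseAlongSteps`, `Regime.charGT`; design point (M) `m := t`), as DEFINITIONS. The PROOFS that close the
statement predicates are res-L1-s46-pv-7's theorems in `Theorems/MarkedTransferCampaignW46LargeCharRegime.lean`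
(p471737 ACCEPTED): this file does NOT import that proof file (statements first; the closing file imports both).
AI review is weaker than expert review. No `sorry`, no theorem.

## What rung (iv) splits into (pv-7's analysis, STATUS 2026-08-26T22:41:48Z; RESCUE-SEED §1 row W4.6 (iv) «large `p`
## relative to dimension/degree»)

* (iv-a) EXISTENCE of resolutions for `p` large relative to `(n, d, l)` — a THEOREM OF THE TREE
  (`Literature.AlgebraicGeometry.Resolution.BierstoneGrigorievMilmanWlodarczyk2011_holds`, Kollár's characteristic-zero
  theorems proved in tree + spreading out + Noetherian induction), here NAMED in the campaign's shape «`∀ (n d l), ∃ p₀,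
  ∀ p > p₀ …`» as the predicates `CampaignW46LargeCharExistence n d l` / `CampaignW46LargeCharHypersurfaceExistence n d`.
  HONEST `C`: the threshold is NOT explicit (the tree's proof is ineffective; BGMW's printed `M ∈ 𝓔^{n+3}` is not
  transcribed), and for EXISTENCE no lower bound on the threshold can be claimed.
* (iv-b) the typed ONE-STEP CERTIFICATE Eq. (127) in the TAME regime, honest-failure form: the witness shape
  `CampaignW46.TameWitness N Rd Rg` (verbatim the signature proposed by pv-7: a state in the regime with a résumé terminal
  at stage `0`, a step, a résumé of the transform, a closed point over the centre off `D′`) and its ∇-centred variant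
  `CampaignW46.TameWitnessNabla` (Th. 16.6 (4) «`D = ∇`»: the centre contains the terminal plat; a closed point over the
  centre), and the statement predicates `CampaignW46TameStall p K n` (every regime) / `CampaignW46LargeCharTameStall p K n`
  (the regimes `Regime.charGT n C`, EVERY explicit `C` — pv-7's proposed item (B) verbatim): a tame witness is
  incompatible with `DecreaseAlongSteps`. READING under design point (M) `m := t`, not a verdict; if the slot planner rules
  `m := t + 1`, (B) lapses (pv-7, loc. cit.) and the stall question is K4.6's (iv′).
* (iv-c)/(iv-d) (threshold monotonicity; termination from a state measure) need no new statement decl; the POSITIVE typed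
  rung (iv) («`TerminatesNabla N Rd (Regime.inter (Regime.charGT n C) <tame regime>)`» from an explicit state measure) is
  NOT typed here — its regime predicate is not yet proposed (pv-7 (C)).

## VACUITY / DEGENERATE-SLICE SELF-CHECK (typer's reading of OUR decls, not a verdict; desk habit «every ℕ binder at 0»)

* `TameWitness` / `TameWitnessNabla` are EXISTENTIALS over posited résumé data (`Resume` = a §15 résumé whose existence
  for a given `E` is Th. 15.10's claim, never asserted; `Step` = a blow-up that is again an ambient datum, a hypothesis):
  they may well be EMPTY for a given `(N, Rd, Rg)` today — nobody has constructed a résumé. Their non-vacuity is exactly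
  pv-7's announced next lemma («every `Step` has a closed point of `Z′` over its centre», so that a witness needs résumé
  data only) and is NOT claimed here.
* `CampaignW46TameStall` / `CampaignW46LargeCharTameStall` are IMPLICATIONS «witness → ¬ one-step shape»: NOT trivially
  true by an empty antecedent in general, and closed UNIFORMLY (for every witness) by pure logic over the definitions plus
  the elementary fact «no `Inv`-string is `<_lex` the empty one» (pv-7's `not_decreaseAlongSteps_of_tameWitness`,
  `…_nabla`, `…_charGT_of_tameWitness`). Their content is the logical incompatibility, which is the point of (B). At
  `n = 0` the strings are strings of `EdgeInv 0` and the statements keep their meaning; `C ↦ 0` gives the regime `0 < p`,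
  i.e. every state.
* `CampaignW46LargeCharExistence n d l`: at `l = 0` (no equations) the zero locus is `𝔸ⁿ_k`, regular, and the slice is
  true by the identity resolution; at `d = 0` the equations are constants (locus `𝔸ⁿ_k` or empty — the empty scheme is not
  integral, so vacuous); at `n = 0` the locus is `Spec k` or empty. The content sits at `n ≥ 2, d ≥ 2, l ≥ 1`, where it is
  the tree's theorem and nothing less; NOT trivially true there (e.g. it fails for the absolute integral closure witnesses
  of `AbsoluteIntegralClosureNoResolution.lean` — which are not of finite type, hence outside the statement).

## Decls

* `CampaignW46.TameWitness N Rd Rg`, `CampaignW46.TameWitnessNabla N Rd Rg` (namespace `…Theorems.CampaignW46`);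
* `CampaignW46TameStall p K n`, `CampaignW46LargeCharTameStall p K n`, `CampaignW46LargeCharExistence n d l`,
  `CampaignW46LargeCharHypersurfaceExistence n d` (namespace `…Theorems`; PREDICATES WITH PARAMETERS — a parameterless
  `def … : Prop` in a Theorems file is relocated by the gate as a «fact»).

## References

* res-L1-s46-pv-7, STATUS 2026-08-26T22:40:24Z / 22:41:48Z (hand-over; proposed signatures (A)/(B)/(C));
  `Theorems/MarkedTransferCampaignW46LargeCharRegime.lean` (p471737; the closers); `Theorems/MarkedTransferCampaignW46TypedProcedure.lean`
  (p468540; module docstring DESIGN POINTS (M)/(REG)/(VAC)); plan/RESCUE-SEED.md §1 row W4.6 (iv) and prior V5 «large `p`: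
  wild data reappear at level 1 via `b!`» (index only); L/res-L0-k46/KILL-TEST-K4.6.md §4 (iv′) (index only).
* H. Hironaka, ms. 2017-03-23: Th. 16.6 (2)/(4) p.84 l.10–20, l.29; Th. 16.13 p.87 l.26–29; Def. 15.11/15.12 p.80 l.29 –
  p.81 l.4 — quoted for scope only, under adjudication, not cited as fact [Hironaka2017].
* Bierstone–Grigoriev–Milman–Włodarczyk, Asian J. Math. 15 (2011), Cor. 7.0.6 — through the tree's named fact
  `BierstoneGrigorievMilmanWlodarczyk2011` (`EffectiveResolution.lean`) and its PROVED discharge only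
  [BierstoneGrigorievMilmanWlodarczyk2011].
-/

noncomputable section

set_option linter.dupNamespace false -- mandated namespace of this single-conjunct summit

open CategoryTheory AlgebraicGeometry TopologicalSpace

namespace Summit.ResolutionOfSingularities.ResolutionOfSingularities.Theorems

universe u

namespace CampaignW46

open Literature.AlgebraicGeometry.Resolution
open Literature.AlgebraicGeometry.Hironaka2017 (S02Preliminaries.closedPoints)
open Literature.AlgebraicGeometry.Hironaka2017.S02Preliminaries hiding closedPoints
open Literature.AlgebraicGeometry.Hironaka2017.Datum
open Literature.AlgebraicGeometry.Hironaka2017.S15ARSchemes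
open Literature.AlgebraicGeometry.Hironaka2017.S16Proof

variable {n : ℕ} {p : ℕ} [Fact p.Prime] {K : Type u} [Field K] [CharP K p]

/-- [OURS · L1 W4.6 (iv)] replaces the role of a COUNTER-INSTANCE SHAPE to Th. 16.6 (2) / Eq. (127) p.84 l.10–20 in the
tame («`p` large») regime of the typed procedure; NOT a statement of the manuscript. **A tame witness** for a notion
instance `N`, a reading `Rd` and a regime `Rg` (res-L1-s46-pv-7's proposed signature VERBATIM, STATUS 2026-08-26T22:41:48Z
(B)): a state `(A, E)` in `Rg` with a résumé `R` read by `Rd` and TERMINAL AT STAGE `0` (`R.m = 0`: every member of `𝔜(0)`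
has `℘` generated in degree one, `Resume.m_eq_zero_iff_genDegOne_zero` of p471737 — design point (M) `m := t`), a step
`s` of the typed procedure from it, a résumé `R′` of the transform `E′` read by `Rd`, and a CLOSED point `ξ′` of `Z′`
over the centre `D` and off `D′ = ∇′ ∩ π⁻¹(D)`. Such a witness contradicts `DecreaseAlongSteps N Rd Rg`
(`not_decreaseAlongSteps_of_tameWitness`, p471737): with `m = 0` the unprimed `Inv`-string is empty and nothing is
`<_lex` it. VACUITY: an existential over POSITED data (résumés, steps) — possibly empty today; its non-vacuity is NOT
claimed here (pv-7's next lemma supplies the closed point over the centre; résumé data remain hypotheses). [folklore] -/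
def TameWitness (N : Notions.{u} n) (Rd : Reading p K N) (Rg : Regime p K) : Prop :=
  ∃ (A : AmbientDatum p K) (E : IdealExponent A.Z) (R : Resume N A E), Rg A E ∧ Rd A E R ∧ R.m = 0 ∧
    ∃ (A' : AmbientDatum p K) (s : Step R A') (R' : Resume N A' s.E'), Rd A' s.E' R' ∧
      ∃ ξ' : A'.Z, ξ' ∈ S02Preliminaries.closedPoints A'.Z ∧ s.π ξ' ∈ (s.D : Set A.Z) ∧
        ξ' ∉ R.mti.DPrime s.π s.D

/-- [OURS · L1 W4.6 (iv)] replaces the role of a COUNTER-INSTANCE SHAPE to Th. 16.6 (2)+(4) / Eq. (127) p.84 l.10–20,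
l.29 («`D = ∇` and hence `∇′ = ∅`») in the tame regime; NOT a statement of the manuscript. **A ∇-centred tame witness**:
as `TameWitness`, but the centre CONTAINS the terminal plat (`∇(E) ⊆ D`, hence `D = ∇(E)` as sets by the centre rule
`IsCentre.subset_nabla` — the Th. 16.6 (4) step; automatic for the ∇-steps `StepNabla` when `∇(E)` is irreducible,
`IsNablaComponent.nabla_subset_of_isIrreducible` of p471737) and the closed point `ξ′` is only asked to lie over the
centre (then `D′ = ∅`, `mtiDatum_dPrime_eq_empty`). Contradicts `DecreaseAlongSteps N Rd Rg`
(`not_decreaseAlongSteps_of_tameWitness_nabla`, p471737). VACUITY: as for `TameWitness`. [folklore] -/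
def TameWitnessNabla (N : Notions.{u} n) (Rd : Reading p K N) (Rg : Regime p K) : Prop :=
  ∃ (A : AmbientDatum p K) (E : IdealExponent A.Z) (R : Resume N A E), Rg A E ∧ Rd A E R ∧ R.m = 0 ∧
    ∃ (A' : AmbientDatum p K) (s : Step R A'), (R.nabla : Set A.Z) ⊆ (s.D : Set A.Z) ∧
      ∃ R' : Resume N A' s.E', Rd A' s.E' R' ∧
        ∃ ξ' : A'.Z, ξ' ∈ S02Preliminaries.closedPoints A'.Z ∧ s.π ξ' ∈ (s.D : Set A.Z)

end CampaignW46

/-- [OURS · L1 W4.6 (iv)] replaces the role of Th. 16.6 (2) / Eq. (127) p.84 l.10–20 read as a ONE-STEP CERTIFICATE in the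
tame regime — honest-failure form, EVERY regime; NOT a statement of the manuscript. **Tame stall (general regime)**: in
characteristic `p`, over the base field `K`, with `n`-component edge invariants, for every notion instance `N`, every
reading `Rd` and every regime `Rg`, a tame witness (`CampaignW46.TameWitness N Rd Rg`) is incompatible with the one-step
shape `CampaignW46.DecreaseAlongSteps N Rd Rg`. CLOSED, for all parameters, by unpacking the witness into res-L1-s46-pv-7's
`CampaignW46.not_decreaseAlongSteps_of_tameWitness` (p471737) — pure logic over the definitions plus «no `Inv`-string is
`<_lex` the empty one»; the prover lands that one-liner, not this file. READING under design point (M) `m := t` of the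
typed-procedure module; NOT a statement about termination. VACUITY: an implication closed uniformly, not by an empty
antecedent; its content is the logical incompatibility (the (127)-reading of rung (iv) is not the bankable one).
[folklore] -/
def CampaignW46TameStall (p : ℕ) [Fact p.Prime] (K : Type u) [Field K] [CharP K p] (n : ℕ) : Prop :=
  ∀ (N : CampaignW46.Notions.{u} n) (Rd : CampaignW46.Reading p K N) (Rg : CampaignW46.Regime p K),
    CampaignW46.TameWitness N Rd Rg → ¬ CampaignW46.DecreaseAlongSteps N Rd Rg

/-- [OURS · L1 W4.6 (iv)] replaces the role of «the typed Th. 16.6 procedure certifies Eq. (127) at every step for `p >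
C(n, b)`» (RESCUE-SEED §1 row W4.6 (iv), over Th. 16.6 (2) p.84 l.10–20) — honest-failure form; NOT a statement of the
manuscript. **Large-characteristic tame stall** (res-L1-s46-pv-7's proposed item (B) VERBATIM, STATUS 2026-08-26T22:41:48Z):
for every notion instance `N`, every reading `Rd` and EVERY EXPLICIT threshold `C : ℕ → ℕ → ℕ`, a tame witness inside the
regime `CampaignW46.Regime.charGT n C` («`C n b < p`») is incompatible with
`CampaignW46.DecreaseAlongSteps N Rd (CampaignW46.Regime.charGT n C)`. CLOSED by
`CampaignW46.not_decreaseAlongSteps_of_tameWitness` / `…_charGT_of_tameWitness` (p471737); the specialisation of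
`CampaignW46TameStall p K n` to the regimes `charGT`. READING under design point (M); if the slot planner rules `m := t + 1`
this statement lapses (its closer uses `m = 0` ⇒ empty string) and the stall question is K4.6's (iv′). VACUITY: as for
`CampaignW46TameStall`; `C ↦ 0` is the regime `0 < p`, i.e. every state. [folklore] -/
def CampaignW46LargeCharTameStall (p : ℕ) [Fact p.Prime] (K : Type u) [Field K] [CharP K p] (n : ℕ) : Prop :=
  ∀ (N : CampaignW46.Notions.{u} n) (Rd : CampaignW46.Reading p K N) (C : ℕ → ℕ → ℕ),
    CampaignW46.TameWitness N Rd (CampaignW46.Regime.charGT n C) →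
      ¬ CampaignW46.DecreaseAlongSteps N Rd (CampaignW46.Regime.charGT n C)

open Literature.AlgebraicGeometry.Resolution in
/-- [OURS · L1 W4.6 (iv)] replaces the role of «the procedure terminates, hence resolution exists, for `p` large relative to
dimension/degree» (RESCUE-SEED §1 row W4.6 (iv); the resolution half of Th. 16.13 p.87 l.26–29 restricted to large `p`) at
the SUMMIT level only — EXISTENCE, with NOTHING of the typed procedure used or concluded; NOT a statement of the manuscript.
**Large-characteristic existence, bounded complexity** (res-L1-s46-pv-7's proposed item (A), STATUS 2026-08-26T22:41:48Z, as
a predicate in `(n, d, l)`): there is a threshold `p₀` such that for every prime `p > p₀`, every perfect field `k` of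
characteristic `p` and every finite set `S` of at most `l` polynomials in `n` variables of total degree at most `d` whose
zero scheme `Spec k[x]/(S) ⊆ 𝔸ⁿ_k` (`affineZeroLocus k n S`) is integral, that scheme has a resolution of singularities
(`Scheme.HasResolution`: a proper birational morphism from a regular scheme). CLOSED at every `(n, d, l)` by
`CampaignW46.largeChar_boundedComplexity_hasResolution n d l` (p471737) = the tree's PROVED named fact
`BierstoneGrigorievMilmanWlodarczyk2011` (`BierstoneGrigorievMilmanWlodarczyk2011_holds`) with the threshold quantifier
moved inside. HONEST `C`: `p₀` is NOT explicit (ineffective Noetherian induction in the tree's proof) and no lower bound is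
claimed. VACUITY: at `l = 0` / `d = 0` / `n = 0` the slice is degenerate-true (locus `𝔸ⁿ_k`, `Spec k`, or empty hence not
integral); the content sits at `n ≥ 2, d ≥ 2, l ≥ 1`. Universe `0` for `k`, as in the Literature fact. [folklore] -/
def CampaignW46LargeCharExistence (n d l : ℕ) : Prop :=
  ∃ p₀ : ℕ, ∀ (p : ℕ), p.Prime → p₀ < p → ∀ (k : Type) [Field k] [CharP k p] [PerfectField k]
    (S : Finset (MvPolynomial (Fin n) k)), S.card ≤ l → (∀ f ∈ S, f.totalDegree ≤ d) →
      IsIntegral (affineZeroLocus k n S) → Scheme.HasResolution (affineZeroLocus k n S)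

open Literature.AlgebraicGeometry.Resolution in
/-- [OURS · L1 W4.6 (iv)] the HYPERSURFACE case of `CampaignW46LargeCharExistence` (one equation, `l = 1`), as a predicate
in `(n, d)`; NOT a statement of the manuscript. There is `p₀` such that for every prime `p > p₀`, every perfect field `k` of
characteristic `p` and every `f ∈ k[x_1, …, x_n]` of total degree `≤ d` with `V(f) ⊆ 𝔸ⁿ_k` integral, `V(f)` has a
resolution of singularities. CLOSED at every `(n, d)` by `CampaignW46.largeChar_hypersurface_hasResolution n d` (p471737).
HONEST `C` and VACUITY as for `CampaignW46LargeCharExistence`. [folklore] -/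
def CampaignW46LargeCharHypersurfaceExistence (n d : ℕ) : Prop :=
  ∃ p₀ : ℕ, ∀ (p : ℕ), p.Prime → p₀ < p → ∀ (k : Type) [Field k] [CharP k p] [PerfectField k]
    (f : MvPolynomial (Fin n) k), f.totalDegree ≤ d → IsIntegral (affineZeroLocus k n {f}) →
      Scheme.HasResolution (affineZeroLocus k n {f})

end Summit.ResolutionOfSingularities.ResolutionOfSingularities.Theorems

end
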